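import Mathlib.Order.Filter.Ultrafilter.Basic
import Mathlib.Analysis.SpecialFunctions.Sqrt

/-!
# Generalised limits along the free ultrafilter `hyperfilter ℕ` (helper for `stub_softExtraction`)

Helper file for stub `stub_softExtraction` (S2c, the soft extraction step) of the birth line of
crux `LocalOhmBV.LocalOhm` (item stmt-AtomisticToContinuum-12009). The bad functional `Λ` of the
extraction is the limit OVER `k` of normalised finite-`N_k` response functionals `Λ_k(F)` which are
only known to be eventually bounded, not convergent; the limit is taken along `hyperfilter ℕ`.
This file records the soft facts used: an `atTop`-eventually bounded real sequence converges along
`hyperfilter ℕ` to its `limUnder`; the generalised limit extends the ordinary limit, is determined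
by eventual values, is linear on eventually bounded sequences and respects eventual bounds; and a
one-line real lemma removing an `ε` under a square root. Pure Mathlib, no definitions.
-/

set_option autoImplicit false

noncomputable section

namespace Summit.AtomisticToContinuum.FouriersLaw.Theorems.LocalOhmBirth.SoftExtraction

open Filter Topology

/-- An `atTop`-eventual property of naturals holds along `hyperfilter ℕ` (which refines the
cofinite filter `= atTop` on `ℕ`). [folklore] -/
theorem hyperfilter_eventually_of_atTop {p : ℕ → Prop} (h : ∀ᶠ k in atTop, p k) :
    ∀ᶠ k in (hyperfilter ℕ : Filter ℕ), p k := by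
  rw [← Nat.cofinite_eq_atTop] at h
  exact hyperfilter_le_cofinite h

/-- An eventually bounded real sequence converges along `hyperfilter ℕ` to its generalised limit
`limUnder (hyperfilter ℕ) u` (compactness of `[-M, M]` and the ultrafilter property). [folklore] -/
theorem hyperfilter_tendsto_limUnder {u : ℕ → ℝ} {M : ℝ} (h : ∀ᶠ k in atTop, |u k| ≤ M) :
    Tendsto u (hyperfilter ℕ : Filter ℕ) (𝓝 (limUnder (hyperfilter ℕ : Filter ℕ) u)) := by
  have hc : IsCompact (Set.Icc (-M) M) := isCompact_Icc
  have hle : (↑((hyperfilter ℕ).map u) : Filter ℝ) ≤ 𝓟 (Set.Icc (-M) M) := by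
    rw [Ultrafilter.coe_map, le_principal_iff, mem_map]
    filter_upwards [hyperfilter_eventually_of_atTop h] with k hk
    exact Set.mem_Icc.2 (abs_le.1 hk)
  obtain ⟨x, -, hx⟩ := hc.ultrafilter_le_nhds _ hle
  rw [Ultrafilter.coe_map] at hx
  exact tendsto_nhds_limUnder ⟨x, hx⟩

/-- The generalised limit extends the ordinary limit. [folklore] -/
theorem hyperfilter_limUnder_eq_of_tendsto {u : ℕ → ℝ} {x : ℝ} (h : Tendsto u atTop (𝓝 x)) :
    limUnder (hyperfilter ℕ : Filter ℕ) u = x := by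
  have hle : (hyperfilter ℕ : Filter ℕ) ≤ atTop := by
    rw [← Nat.cofinite_eq_atTop]
    exact hyperfilter_le_cofinite
  exact (h.mono_left hle).limUnder_eq

/-- The generalised limit of an eventually constant sequence is that constant. [folklore] -/
theorem hyperfilter_limUnder_eq_of_eventually_eq {u : ℕ → ℝ} {x : ℝ}
    (h : ∀ᶠ k in atTop, u k = x) : limUnder (hyperfilter ℕ : Filter ℕ) u = x :=
  hyperfilter_limUnder_eq_of_tendsto (tendsto_const_nhds.congr' (h.mono fun _ hk => hk.symm))

/-- Linearity of the generalised limit on eventually bounded sequences: if `w = c₁ u + c₂ v`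
eventually and `u`, `v` are eventually bounded then `LIM w = c₁ LIM u + c₂ LIM v`. [folklore] -/
theorem hyperfilter_limUnder_linear :
    ∀ {u v w : ℕ → ℝ} {Mu Mv : ℝ} (c₁ c₂ : ℝ), (∀ᶠ k in atTop, |u k| ≤ Mu) →
      (∀ᶠ k in atTop, |v k| ≤ Mv) → (∀ᶠ k in atTop, w k = c₁ * u k + c₂ * v k) →
      limUnder (hyperfilter ℕ : Filter ℕ) w =
        c₁ * limUnder (hyperfilter ℕ : Filter ℕ) u + c₂ * limUnder (hyperfilter ℕ : Filter ℕ) v := by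
  intro u v w Mu Mv c₁ c₂ hu hv hw
  have h := ((hyperfilter_tendsto_limUnder hu).const_mul c₁).add
    ((hyperfilter_tendsto_limUnder hv).const_mul c₂)
  exact (h.congr' ((hyperfilter_eventually_of_atTop hw).mono fun _ hk => hk.symm)).limUnder_eq

/-- Eventual bounds pass to the generalised limit. [folklore] -/
theorem hyperfilter_abs_limUnder_le {u : ℕ → ℝ} {M : ℝ} (h : ∀ᶠ k in atTop, |u k| ≤ M) :
    |limUnder (hyperfilter ℕ : Filter ℕ) u| ≤ M :=
  le_of_tendsto ((continuous_abs.tendsto _).comp (hyperfilter_tendsto_limUnder h))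
    (hyperfilter_eventually_of_atTop h)

/-- Removing an `ε` under a square root: if `t ≤ A · √(S + ε)` for every `ε > 0` then
`t ≤ A · √S` (continuity of `√·`). [folklore] -/
theorem le_mul_sqrt_of_forall_pos {t A S : ℝ} (h : ∀ ε : ℝ, 0 < ε → t ≤ A * Real.sqrt (S + ε)) :
    t ≤ A * Real.sqrt S := by
  have hc : Tendsto (fun ε : ℝ => A * Real.sqrt (S + ε)) (𝓝[>] 0) (𝓝 (A * Real.sqrt (S + 0))) :=
    ((continuous_const.mul ((continuous_const.add continuous_id).sqrt)).tendsto 0).mono_left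
      nhdsWithin_le_nhds
  rw [add_zero] at hc
  exact ge_of_tendsto hc (eventually_nhdsWithin_of_forall fun ε hε => h ε hε)

/-- A sequence bounded in absolute value by `A · √(I_k)` with `I_k ≤ S + ε` eventually is eventually
bounded by `A · √(S + ε)` (`A ≥ 0`). [folklore] -/
theorem eventually_abs_le_mul_sqrt {u I : ℕ → ℝ} {A S ε : ℝ} (hA : 0 ≤ A)
    (hu : ∀ᶠ k in atTop, |u k| ≤ A * Real.sqrt (I k)) (hI : ∀ᶠ k in atTop, I k ≤ S + ε) :
    ∀ᶠ k in atTop, |u k| ≤ A * Real.sqrt (S + ε) := by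
  filter_upwards [hu, hI] with k hk hk'
  exact hk.trans (mul_le_mul_of_nonneg_left (Real.sqrt_le_sqrt hk') hA)

end Summit.AtomisticToContinuum.FouriersLaw.Theorems.LocalOhmBirth.SoftExtraction

end
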